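import Summits.QuantumFields.YangMills.Theorems.LuscherReductionTwistedTraceScalingBTCorePair
import Summits.QuantumFields.YangMills.Theorems.LuscherReductionTwistedTraceScalingBTTailKernel
import Summits.QuantumFields.YangMills.Theorems.LuscherReductionTwistedTraceScalingBTCoreWeight
import HarnessLib

/-!
# (B-T) AT FIXED `β`: the pointwise kernel comparison `|fpBOKernel(W)(u,u') − C·K₁(u,u')| ≤ κ·C·K₁(u,u') + τ` on the slow window, for EXPLICIT `C, κ, τ`, under EXPLICIT
# smallness conditions on the radii (lane A of S-BASE, crux `TwistedTraceScaling` stmt-QuantumFields-20203, C4-CORE, the (B-T) pen; design note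
# `pub/ym-fleet/ym-luscher-20007-p1/COARSE-DESIGN.md` §25.6–§25.9)

This is the `hpt` hypothesis of the door `…BTPointwiseTail.hT_of_fp_add` at one value of `β`, assembled from the landed engines:
near pairs (`‖q(u_k) − q(u'_k)‖ ≤ α` ∀k) — `…BTCorePair.core_pair_two_sided` on the core weight plus `…BTTailKernel.kinDefect_ge_off_core` + `…BTTails.fpBOKernel_le_of_kernel_le` on
the tail weight; far pairs — `…BTTailKernel.kinDefect_ge_far` for the whole weight plus `…BTWindow.transferKernel_one_site_le_exp` for `C·K₁`.
* `btC` (`= fpBOKernel(coreWeight)(1,1)/K₁(1,1)`), `btKappa` (`= |e^{η}(1+ε₂+(ε₁+ε₂)²) − 1| + |e^{−η}(1−ε₂) − 1|`), `btMnt`, `btMfar` (tail defect floors), `btTau`;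
* ★★★ `fixed_beta_estimate` — the comparison for every pair of the window `orbitDist < δ`.
What remains for (B-T): the β-schedule of the radii and the eventual verification of the smallness conditions, `hτZ`, and the call to `hT_of_fp_add` (seat NOTES, `BTRates`/`BTAssembly`).
HONEST FRAMING: a stub of a child of the CONDITIONAL reduction route R2b1; C4-CORE OPEN; not infinite volume, not a gap, not Clay.
-/

set_option autoImplicit false

noncomputable section

open MeasureTheory Filter Topology Real
open scoped BigOperators Matrix Quaternion
open Literature.MathematicalPhysics.QuantumFieldTheory
open Literature.MathematicalPhysics.QuantumLattice

namespace Summit.QuantumFields.YangMills.Theorems.FemtoTransferGap.TwoLattice.ConstTube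

open Summit.QuantumFields.YangMills.Theorems.FemtoTransferGap
open Summit.QuantumFields.YangMills.Theorems.FemtoTransferGap.TwoLattice
open Summit.QuantumFields.YangMills.Theorems.FemtoTransferGap.TwoLattice.Avg
open Summit.QuantumFields.YangMills.Theorems.FemtoTransferGap.TwoLattice.Stiff (LinkSpace)

variable (L : ℕ) [NeZero L]

/-- **The (B-T) constant** `C = fpBOKernel(coreWeight)(1,1)/K₁^{(L³β)}(1,1)`. [cite: Luscher1983, §3] -/
def btC (β : ℝ) (Ω : LinkSpace L → ℝ) (ε R₁ : ℝ) : ℝ :=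
  fpBOKernel L β Ω (coreWeight L ε R₁) 1 1 / transferKernel su2Rep ((L : ℝ) ^ 3 * β) (1 : GaugeConfig 3 1 SU2) 1

/-- **The relative rate** `κ = |e^{η}(1 + ε₂ + (ε₁+ε₂)²) − 1| + |e^{−η}(1 − ε₂) − 1|`. [folklore] -/
def btKappa (β δ α T R Γ σ : ℝ) : ℝ :=
  |Real.exp (coreEta L β δ α T R Γ σ) * (1 + coreEps2 L β δ T R σ + (coreEps1 L β δ T R + coreEps2 L β δ T R σ) ^ 2) - 1| +
    |Real.exp (-coreEta L β δ α T R Γ σ) * (1 - coreEps2 L β δ T R σ) - 1|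

/-- **Near-pair tail defect floor** `m_nt = (min (R₁/2 − 2aε − b) (1/(3L) − 4a − b))²`, `a = √2R + δ`, `b = 2√2R + α`. [folklore] -/
def btMnt (δ α R R₁ ε : ℝ) : ℝ :=
  (min (R₁ / 2 - 2 * (Real.sqrt 2 * R + δ) * ε - (2 * Real.sqrt 2 * R + α)) (1 / (3 * L) - 4 * (Real.sqrt 2 * R + δ) - (2 * Real.sqrt 2 * R + α))) ^ 2

/-- **Far-pair defect floor** `m_far`. [folklore] -/
def btMfar (δ α R ε P₀ : ℝ) : ℝ :=
  min ((P₀ - 4 * (Real.sqrt 2 * R + δ) - (2 * Real.sqrt 2 * R + 2 * δ)) ^ 2)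
    ((Fintype.card (Site 3 L) * (1 - 3 * L * P₀) * α -
        (2 * ε * Fintype.card (Site 3 L) * δ + 2 * R ^ 2 + 2 * Real.sqrt 2 * Fintype.card (Site 3 L) * (9 * L * P₀ + ε) * R)) ^ 2 / Fintype.card (Edge 3 L))

/-- **The absolute tail** `τ = e^{2β|E|}(e^{−β m_nt} + e^{−β m_far})(∫Ω dπ)² + C·e^{L³β(6 − α²)}`. [folklore] -/
def btTau (β : ℝ) (Ω : LinkSpace L → ℝ) (δ α R R₁ ε P₀ C : ℝ) : ℝ :=
  Real.exp (β * (2 * (Fintype.card (Edge 3 L) : ℝ))) * (Real.exp (-(β * btMnt L δ α R R₁ ε)) + Real.exp (-(β * btMfar L δ α R ε P₀))) *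
      (∫ v, Ω (linkEmbed L v) ∂orthoTransverse L) ^ 2 +
    C * Real.exp ((L : ℝ) ^ 3 * β * (6 - α ^ 2))

variable {L}

/-- `∫ W dg ≤ 1` for a weight in `[0,1]`. [folklore] -/
theorem integral_weight_le_one {W : (Site 3 L → SU2) → ℝ} (hW : Measurable W) (hW1 : ∀ g, 0 ≤ W g ∧ W g ≤ 1) : ∫ g, W g ∂gaugeMeasure L ≤ 1 := by
  haveI : IsProbabilityMeasure (gaugeMeasure L) := by unfold gaugeMeasure; infer_instance
  have h := integral_mono (integrable_of_measurable_abs_le (gaugeMeasure L) hW (C := 1) fun g => by rw [abs_of_nonneg (hW1 g).1]; exact (hW1 g).2)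
    (integrable_const (1 : ℝ)) fun g => (hW1 g).2
  simpa using h

/-- ★★★ **(B-T) AT FIXED `β`.** [cite: Luscher1983, §3] -/
theorem fixed_beta_estimate {β : ℝ} (hβ : 0 ≤ β) {Ω : LinkSpace L → ℝ} (hΩm : Measurable Ω) (hΩ1 : ∀ x, |Ω x| ≤ 1) (hΩ0 : ∀ x, 0 ≤ Ω x)
    (hΩinv : ∀ (g : SU2) (x : LinkSpace L), Ω (adL L g x) = Ω x) {δ α t R R₁ ε P₀ : ℝ}
    (hΩt : ∀ v : Edge 3 L → Fin 3 → ℝ, Ω (linkEmbed L v) ≠ 0 → (∀ (e : Edge 3 L) (c : Fin 3), |v e c| ≤ t) ∧ ‖linkEmbed L v‖ ≤ R)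
    (hδ2 : δ ≤ 1 / 2) (hα0 : 0 ≤ α) (hα1 : α ≤ 1) (hε0 : 0 ≤ ε)
    (htT : t ≤ 9 * L * R₁ + ε) (hT : 9 * L * R₁ + ε ≤ 1 / 30) (hσ : (L : ℝ) ^ 3 * (12 * δ ^ 4) < 2)
    (hεsum : coreEps1 L β δ (9 * L * R₁ + ε) R + coreEps2 L β δ (9 * L * R₁ + ε) R ((L : ℝ) ^ 3 * (12 * δ ^ 4)) ≤ 1)
    (hLa : 18 * L * (Real.sqrt 2 * R + δ) ≤ 1 / 2)
    (hm₁ : 0 ≤ R₁ / 2 - 2 * (Real.sqrt 2 * R + δ) * ε - (2 * Real.sqrt 2 * R + α)) (hm₂ : 0 ≤ 1 / (3 * L) - 4 * (Real.sqrt 2 * R + δ) - (2 * Real.sqrt 2 * R + α))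
    (hP : 3 * L * P₀ < 1) (hP0 : 0 ≤ P₀ - 4 * (Real.sqrt 2 * R + δ) - (2 * Real.sqrt 2 * R + 2 * δ))
    (hJ : 2 * ε * Fintype.card (Site 3 L) * δ + 2 * R ^ 2 + 2 * Real.sqrt 2 * Fintype.card (Site 3 L) * (9 * L * P₀ + ε) * R ≤ Fintype.card (Site 3 L) * (1 - 3 * L * P₀) * α)
    (u u' : GaugeConfig 3 1 SU2) (hu : orbitDist u < δ) (hu' : orbitDist u' < δ) :
    |fpBOKernel L β Ω (fpWeight L ε) u u' - btC L β Ω ε R₁ * transferKernel su2Rep ((L : ℝ) ^ 3 * β) u u'| ≤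
      btKappa L β δ α (9 * L * R₁ + ε) R (ε * Fintype.card (Site 3 L)) ((L : ℝ) ^ 3 * (12 * δ ^ 4)) * btC L β Ω ε R₁ * transferKernel su2Rep ((L : ℝ) ^ 3 * β) u u' +
        btTau L β Ω δ α R R₁ ε P₀ (btC L β Ω ε R₁) := by
  -- abbreviations
  set T : ℝ := 9 * L * R₁ + ε with hTdef
  set σ : ℝ := (L : ℝ) ^ 3 * (12 * δ ^ 4) with hσdef
  set Γ : ℝ := ε * Fintype.card (Site 3 L) with hΓdef
  set C : ℝ := btC L β Ω ε R₁ with hCdef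
  set K : ℝ := transferKernel su2Rep ((L : ℝ) ^ 3 * β) u u' with hKdef
  have hK : 0 < K := transferKernel_pos _ _ _ _
  have hK1 : 0 < transferKernel su2Rep ((L : ℝ) ^ 3 * β) (1 : GaugeConfig 3 1 SU2) 1 := transferKernel_pos _ _ _ _
  have hL1 : (1 : ℝ) ≤ L := by exact_mod_cast NeZero.one_le
  have hN : (0 : ℝ) < Fintype.card (Site 3 L) := by exact_mod_cast Fintype.card_pos
  -- the weights
  have hWc := measurable_coreWeight (L := L) ε R₁
  have hWt := measurable_tailWeight (L := L) ε R₁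
  have hWf := measurable_fpWeight L ε
  have hC0 : 0 ≤ C := div_nonneg (fpBOKernel_nonneg β hΩm hΩ1 hΩ0 hWc (abs_coreWeight_le ε R₁) (fun g => (coreWeight_mem_Icc ε R₁ g).1) 1 1) hK1.le
  -- window facts
  have hδu : ∀ e : Edge 3 1, ‖su2Quat (u e) - 1‖ ≤ δ := fun e => (norm_su2Quat_sub_one_le_orbitDist u e).trans hu.le
  have hδu' : ∀ e : Edge 3 1, ‖su2Quat (u' e) - 1‖ ≤ δ := fun e => (norm_su2Quat_sub_one_le_orbitDist u' e).trans hu'.le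
  have hδ0 : 0 ≤ δ := (norm_nonneg _).trans (hδu (0, 0))
  have hS : (L : ℝ) ^ 3 * wilsonAction su2Rep u ≤ σ := mul_le_mul_of_nonneg_left (wilsonAction_one_site_le u hδu) (by positivity)
  have hS' : (L : ℝ) ^ 3 * wilsonAction su2Rep u' ≤ σ := mul_le_mul_of_nonneg_left (wilsonAction_one_site_le u' hδu') (by positivity)
  have hσ0 : 0 ≤ σ := by positivity
  have hduu' : ∀ k : Fin 3, ‖su2Quat (u (0, k)) - su2Quat (u' (0, k))‖ ≤ 2 * δ := fun k => by
    have := norm_sub_le_norm_sub_add_norm_sub (su2Quat (u (0, k))) 1 (su2Quat (u' (0, k)))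
    rw [norm_sub_rev (1 : ℍ)] at this; linarith [hδu (0, k), hδu' (0, k)]
  -- tube-link bounds on the supports
  have hv1_of : ∀ v : Edge 3 L → Fin 3 → ℝ, v ∈ capBalancedSet L → ∀ e, ∑ a, v e a ^ 2 ≤ 1 := fun v hv => sum_sq_le_one_of_cap L hv.2
  have ha_of : ∀ v : Edge 3 L → Fin 3 → ℝ, v ∈ capBalancedSet L → Ω (linkEmbed L v) ≠ 0 → ∀ e : Edge 3 L, ‖su2Quat (orthoTube L u v e) - 1‖ ≤ Real.sqrt 2 * R + δ :=
    fun v hv hΩv e => (norm_su2Quat_orthoTube_sub_one_le u (hv1_of v hv) e).trans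
      (add_le_add (mul_le_mul_of_nonneg_left (hΩt v hΩv).2 (Real.sqrt_nonneg _)) (hδu (0, e.2)))
  have hb_of : ∀ v v' : Edge 3 L → Fin 3 → ℝ, v ∈ capBalancedSet L → v' ∈ capBalancedSet L → Ω (linkEmbed L v) ≠ 0 → Ω (linkEmbed L v') ≠ 0 → ∀ {d : ℝ},
      (∀ k : Fin 3, ‖su2Quat (u (0, k)) - su2Quat (u' (0, k))‖ ≤ d) → ∀ e : Edge 3 L, ‖su2Quat (orthoTube L u v e) - su2Quat (orthoTube L u' v' e)‖ ≤ 2 * Real.sqrt 2 * R + d :=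
    fun v v' hv hv' hΩv hΩv' d hd e => (norm_su2Quat_orthoTube_sub_orthoTube_le u u' (hv1_of v hv) (hv1_of v' hv') e).trans (by
      have h1 := mul_le_mul_of_nonneg_left (hΩt v hΩv).2 (Real.sqrt_nonneg 2)
      have h2 := mul_le_mul_of_nonneg_left (hΩt v' hΩv').2 (Real.sqrt_nonneg 2)
      linarith [hd e.2])
  have hE2 : 0 ≤ β * (2 * (Fintype.card (Edge 3 L) : ℝ)) := by positivity
  have hsplit := fpBOKernel_fpWeight_split (L := L) β ε R₁ hΩm hΩ1 u u'
  have hτ_nt : 0 ≤ Real.exp (β * (2 * (Fintype.card (Edge 3 L) : ℝ))) * Real.exp (-(β * btMnt L δ α R R₁ ε)) * (∫ v, Ω (linkEmbed L v) ∂orthoTransverse L) ^ 2 := by positivity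
  have hτ_far : 0 ≤ Real.exp (β * (2 * (Fintype.card (Edge 3 L) : ℝ))) * Real.exp (-(β * btMfar L δ α R ε P₀)) * (∫ v, Ω (linkEmbed L v) ∂orthoTransverse L) ^ 2 := by positivity
  have hτ_K : 0 ≤ C * Real.exp ((L : ℝ) ^ 3 * β * (6 - α ^ 2)) := by positivity
  have hκ0 : 0 ≤ btKappa L β δ α T R Γ σ := by unfold btKappa; positivity
  have hτeq : btTau L β Ω δ α R R₁ ε P₀ C = Real.exp (β * (2 * (Fintype.card (Edge 3 L) : ℝ))) * Real.exp (-(β * btMnt L δ α R R₁ ε)) * (∫ v, Ω (linkEmbed L v) ∂orthoTransverse L) ^ 2 +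
      Real.exp (β * (2 * (Fintype.card (Edge 3 L) : ℝ))) * Real.exp (-(β * btMfar L δ α R ε P₀)) * (∫ v, Ω (linkEmbed L v) ∂orthoTransverse L) ^ 2 +
      C * Real.exp ((L : ℝ) ^ 3 * β * (6 - α ^ 2)) := by unfold btTau; ring
  by_cases hnear : ∀ k : Fin 3, ‖su2Quat (u (0, k)) - su2Quat (u' (0, k))‖ ≤ α
  · -- NEAR PAIR: core sandwich + off-core tail
    have hWcs : ∀ g : Site 3 L → SU2, coreWeight L ε R₁ g ≠ 0 → (∀ x, ‖su2Quat (g x) - 1‖ ≤ T) ∧ ‖∑ x, vecPart (g x)‖ ≤ Γ := by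
      intro g hg
      obtain ⟨hcore, hpin⟩ := mem_of_coreWeight_ne_zero hg
      have hjumps : ∀ e : Edge 3 L, ‖su2Quat (g (e.1.shift e.2)) - su2Quat (g e.1)‖ ≤ R₁ := fun e => (hcore e).le
      have h3 : 3 * L * R₁ < 1 := by nlinarith
      refine ⟨fun x => norm_su2Quat_sub_one_le_of_jumps (L := L) hjumps h3 hpin x, ?_⟩
      have hpath := norm_su2Quat_sub_base_le (L := L) hjumps
      have hS0 := colourQuatSum_ne_zero_of_near (L := L) h3 hpath
      have hSle : ‖colourQuatSum L g‖ ≤ Fintype.card (Site 3 L) := by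
        unfold colourQuatSum
        refine (norm_sum_le _ _).trans ?_
        simp only [norm_su2Quat, Finset.sum_const, Finset.card_univ, nsmul_eq_mul, mul_one, le_refl]
      calc ‖∑ x, vecPart (g x)‖ ≤ ‖colourQuatSum L g - ‖colourQuatSum L g‖ • (1 : ℍ)‖ := norm_sum_vecPart_le g
        _ ≤ ε * ‖colourQuatSum L g‖ := norm_colourQuatSum_sub_smul_one_le hS0 hpin
        _ ≤ ε * Fintype.card (Site 3 L) := mul_le_mul_of_nonneg_left hSle hε0
    have hsand := core_pair_two_sided hβ hΩm hΩ1 hΩ0 hΩinv hWc (abs_coreWeight_le ε R₁) (fun g => (coreWeight_mem_Icc ε R₁ g).1) (coreWeight_conj ε R₁) u u'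
      (fun k => hδu (0, k)) hδ2 hnear hα1 htT hT hσ hσ0 hS hS' hΩt hWcs hεsum
    -- core part: `|X − CK| ≤ κ C K`
    have hcore : |fpBOKernel L β Ω (coreWeight L ε R₁) u u' - C * K| ≤ btKappa L β δ α T R Γ σ * C * K := by
      have hC' : fpBOKernel L β Ω (coreWeight L ε R₁) 1 1 / transferKernel su2Rep ((L : ℝ) ^ 3 * β) (1 : GaugeConfig 3 1 SU2) 1 = C := by rw [hCdef]; rfl
      have h1 := hsand.1
      have h2 := hsand.2
      rw [hC', ← hKdef] at h1 h2
      rw [div_le_iff₀ hK] at h2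
      rw [le_div_iff₀ hK] at h1
      unfold btKappa
      have hCK : 0 ≤ C * K := mul_nonneg hC0 hK.le
      have m1 := mul_le_mul_of_nonneg_right (neg_abs_le (Real.exp (-coreEta L β δ α T R Γ σ) * (1 - coreEps2 L β δ T R σ) - 1)) hCK
      have m2 := mul_le_mul_of_nonneg_right
        (le_abs_self (Real.exp (coreEta L β δ α T R Γ σ) * (1 + coreEps2 L β δ T R σ + (coreEps1 L β δ T R + coreEps2 L β δ T R σ) ^ 2) - 1)) hCK
      have a0 := mul_nonneg (abs_nonneg (Real.exp (coreEta L β δ α T R Γ σ) * (1 + coreEps2 L β δ T R σ + (coreEps1 L β δ T R + coreEps2 L β δ T R σ) ^ 2) - 1)) hCK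
      have b0 := mul_nonneg (abs_nonneg (Real.exp (-coreEta L β δ α T R Γ σ) * (1 - coreEps2 L β δ T R σ) - 1)) hCK
      rw [abs_le]
      constructor
      · linarith
      · linarith
    -- tail part: `fp(tailWeight) ≤ e^{2β|E|} e^{−β m_nt} (∫Ω)²`
    have htail : fpBOKernel L β Ω (tailWeight L ε R₁) u u' ≤
        Real.exp (β * (2 * (Fintype.card (Edge 3 L) : ℝ))) * Real.exp (-(β * btMnt L δ α R R₁ ε)) * (∫ v, Ω (linkEmbed L v) ∂orthoTransverse L) ^ 2 := by
      have hk : ∀ (v v' : Edge 3 L → Fin 3 → ℝ) (g : Site 3 L → SU2), v ∈ capBalancedSet L → v' ∈ capBalancedSet L → Ω (linkEmbed L v) ≠ 0 → Ω (linkEmbed L v') ≠ 0 →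
          tailWeight L ε R₁ g ≠ 0 → transferKernel su2Rep β (orthoTube L u v) (gaugeTransform g (orthoTube L u' v')) ≤
            Real.exp (β * (2 * (Fintype.card (Edge 3 L) : ℝ))) * Real.exp (-(β * btMnt L δ α R R₁ ε)) := by
        intro v v' g hv hv' hΩv hΩv' hg
        obtain ⟨hoff, hpin⟩ := mem_of_tailWeight_ne_zero hg
        have hdef := kinDefect_ge_off_core (orthoTube L u v) (orthoTube L u' v') g (ha_of v hv hΩv) (hb_of v v' hv hv' hΩv hΩv' hnear) hpin hLa
          (exists_jump_ge_of_not_mem_coreSet hoff) hm₁ hm₂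
        refine (transferKernel_gaugeTransform_le hβ _ _ g).trans ?_
        rw [← Real.exp_add]
        refine Real.exp_le_exp.mpr ?_
        unfold btMnt
        linarith [mul_le_mul_of_nonneg_left hdef hβ]
      have h := fpBOKernel_le_of_kernel_le β hΩm hΩ1 hΩ0 hWt (abs_tailWeight_le ε R₁) (fun g => (tailWeight_mem_Icc ε R₁ g).1) u u' (by positivity) hk
      have hW1 := integral_weight_le_one hWt (tailWeight_mem_Icc (L := L) ε R₁)
      have hI0 : 0 ≤ ∫ g, tailWeight L ε R₁ g ∂gaugeMeasure L := integral_nonneg fun g => (tailWeight_mem_Icc ε R₁ g).1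
      refine h.trans ?_
      have := mul_le_mul_of_nonneg_left hW1 (by positivity :
        (0 : ℝ) ≤ Real.exp (β * (2 * (Fintype.card (Edge 3 L) : ℝ))) * Real.exp (-(β * btMnt L δ α R R₁ ε)) * (∫ v, Ω (linkEmbed L v) ∂orthoTransverse L) ^ 2)
      linarith [this]
    rw [hsplit, hτeq]
    have := abs_add_le (fpBOKernel L β Ω (coreWeight L ε R₁) u u' - C * K) (fpBOKernel L β Ω (tailWeight L ε R₁) u u')
    rw [abs_of_nonneg (fpBOKernel_nonneg β hΩm hΩ1 hΩ0 hWt (abs_tailWeight_le ε R₁) (fun g => (tailWeight_mem_Icc ε R₁ g).1) u u')] at this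
    have e : fpBOKernel L β Ω (coreWeight L ε R₁) u u' + fpBOKernel L β Ω (tailWeight L ε R₁) u u' - C * K =
        (fpBOKernel L β Ω (coreWeight L ε R₁) u u' - C * K) + fpBOKernel L β Ω (tailWeight L ε R₁) u u' := by ring
    rw [e]
    linarith
  · -- FAR PAIR: everything is in the absolute tail
    push Not at hnear
    obtain ⟨k, hk⟩ := hnear
    have hfp : fpBOKernel L β Ω (fpWeight L ε) u u' ≤
        Real.exp (β * (2 * (Fintype.card (Edge 3 L) : ℝ))) * Real.exp (-(β * btMfar L δ α R ε P₀)) * (∫ v, Ω (linkEmbed L v) ∂orthoTransverse L) ^ 2 := by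
      have hkb : ∀ (v v' : Edge 3 L → Fin 3 → ℝ) (g : Site 3 L → SU2), v ∈ capBalancedSet L → v' ∈ capBalancedSet L → Ω (linkEmbed L v) ≠ 0 → Ω (linkEmbed L v') ≠ 0 →
          fpWeight L ε g ≠ 0 → transferKernel su2Rep β (orthoTube L u v) (gaugeTransform g (orthoTube L u' v')) ≤
            Real.exp (β * (2 * (Fintype.card (Edge 3 L) : ℝ))) * Real.exp (-(β * btMfar L δ α R ε P₀)) := by
        intro v v' g hv hv' hΩv hΩv' hg
        have hpin := mem_fpBall_of_fpWeight_ne_zero hg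
        have hdef := kinDefect_ge_far u u' hv hv' g (ha_of v hv hΩv) (hb_of v v' hv hv' hΩv hΩv' hduu') hε0 hpin (fun k => hδu (0, k)) ⟨k, hk.le⟩
          (hΩt v hΩv).2 (hΩt v' hΩv').2 hP hP0 hJ
        refine (transferKernel_gaugeTransform_le hβ _ _ g).trans ?_
        rw [← Real.exp_add]
        refine Real.exp_le_exp.mpr ?_
        unfold btMfar
        linarith [mul_le_mul_of_nonneg_left hdef hβ]
      have h := fpBOKernel_le_of_kernel_le β hΩm hΩ1 hΩ0 hWf (abs_fpWeight_le L ε) (fun g => (fpWeight_mem_Icc L ε g).1) u u' (by positivity) hkb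
      have hW1 := integral_weight_le_one hWf (fpWeight_mem_Icc L ε)
      refine h.trans ?_
      have := mul_le_mul_of_nonneg_left hW1 (by positivity :
        (0 : ℝ) ≤ Real.exp (β * (2 * (Fintype.card (Edge 3 L) : ℝ))) * Real.exp (-(β * btMfar L δ α R ε P₀)) * (∫ v, Ω (linkEmbed L v) ∂orthoTransverse L) ^ 2)
      linarith [this]
    have hCK : C * K ≤ C * Real.exp ((L : ℝ) ^ 3 * β * (6 - α ^ 2)) := by
      refine mul_le_mul_of_nonneg_left ?_ hC0
      refine (transferKernel_one_site_le_exp (by positivity : (0 : ℝ) ≤ (L : ℝ) ^ 3 * β) u u' k).trans (Real.exp_le_exp.mpr ?_)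
      have hsq : α ^ 2 ≤ ‖su2Quat (u (0, k)) - su2Quat (u' (0, k))‖ ^ 2 := pow_le_pow_left₀ hα0 hk.le 2
      linarith [mul_le_mul_of_nonneg_left hsq (by positivity : (0 : ℝ) ≤ (L : ℝ) ^ 3 * β)]
    have hfp0 : 0 ≤ fpBOKernel L β Ω (fpWeight L ε) u u' := fpBOKernel_nonneg β hΩm hΩ1 hΩ0 hWf (abs_fpWeight_le L ε) (fun g => (fpWeight_mem_Icc L ε g).1) u u'
    have hCK0 : 0 ≤ C * K := mul_nonneg hC0 hK.le
    have hκCK := mul_nonneg hκ0 hCK0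
    rw [hτeq, abs_le]
    constructor
    · linarith
    · linarith

end Summit.QuantumFields.YangMills.Theorems.FemtoTransferGap.TwoLattice.ConstTube

end
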